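/-
Copyright (c) 2026. All rights reserved.
Released under Apache 2.0 license as described in the file LICENSE.
-/
import Summits.AtomisticToContinuum.Crystallization.Theorems.ChartedZeroExcessLayeredLatticeLiouvilleVP

/-!
# ChartedZeroExcessLayeredLatticeLiouville — part VQ «IncrementCoercive II»: the ramp closure and the COERCIVITY OF THE FLUX BLOCKS on every
  window (decomp-a2c-lens-2, g58; helper of stmt-AtomisticToContinuum-26636, leaf (LD′) `ModalLipschitzZ`; brick (3) MODE EXTRACTION, critic
  rows 929 (b) / 938 (a) / 941 (e))

★★ `flux_coercive`: under VL's hypotheses (co-Lipschitz layered crystal, `CoerciveZ (layeredKernel a b w) κ₀`, tail hypothesis with constant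
`ε ≤ 2κ₀`, `0 ≤ ϱ`), for EVERY finite window `W ⊆ ℤ` of gaps and EVERY increment field `d`,
  `(κ₀ − ε/2)·Σ_{m ∈ W} ‖d m‖² ≤ Σ_{m ∈ W} ⟪d m, blockApply (fluxBlock …) W d m⟫`
— hypothesis `hco` of VM `window_exists` / VN `window_solve` with `δ = κ₀ − ε/2`, uniformly in the window and in `ϱ` (the modulus of the brief is
chosen before `ϱ`, row 938 (a)).  No carrier, no symmetry and no self-adjointness of the blocks is needed.
Proof (the FAR SLOW RAMP): an increment field supported in `W` is not the increment field of a finitely supported profile unless `Σ_W d = 0`;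
close it by `M` equal steps `−M⁻¹•(Σ_W d)` on the gaps `[N, N + M)`, `N = max W + r + 2` (`r = ⌊ϱ/c⌋₊`).  The closed field has a finitely
supported profile (VP `primZ`), so VL `chainCoercive_of_coerciveZ_sum` + `chainForm_eq_sum` and VO `chainForm_eq_two_mul_sum_inner_chainFlux` give
`(2κ₀ − ε)·Σ_W ‖d‖² ≤ 2·Σ_m ⟪closed field m, chainFlux m⟫`; in VP's increment form the window share of the pairing is EXACTLY
`Σ_W ⟪d m, blockApply (fluxBlock …) W d m⟫` (the ramp sits more than `r` gaps above `W`: no cross blocks), and the ramp share is at most `M` terms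
of size `(M⁻¹‖D‖)·(2r+1)·fluxConst·(M⁻¹‖D‖)`, i.e. `O(1/M)`; let `M → ∞` (`flux_coercive_step`, `flux_coercive_of_support`), then drop the support
hypothesis (both sides only see `d` on `W`).
-/

namespace Summit.AtomisticToContinuum.Crystallization.Theorems.ChartedZeroExcessLayeredLatticeLiouville

open Summit.AtomisticToContinuum.Crystallization.Theorems.ChartedPlanarOrderRigidityDoor (E3)
open Finset
open scoped InnerProductSpace RealInnerProductSpace BigOperators

noncomputable section IncrementCoercive

variable {c : ℝ} {a b : E3} {w : ℤ → E3}

/-! ### VQ.1  The ramp -/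

/-- the RAMP increments: `M` equal steps `M⁻¹ • D` on the gaps `[N, N + M)`, zero elsewhere. [this file, g58] -/
def ramp (D : E3) (N : ℤ) (M : ℕ) (k : ℤ) : E3 :=
  if N ≤ k ∧ k < N + M then ((M : ℝ)⁻¹) • D else 0

/-- the ramp vanishes below its foot. [formal bookkeeping] -/
theorem ramp_eq_zero_of_lt (D : E3) {N : ℤ} (M : ℕ) {k : ℤ} (h : k < N) : ramp D N M k = 0 := by
  unfold ramp
  rw [if_neg (fun hk => (not_le.mpr h) hk.1)]

/-- every ramp step has norm at most `M⁻¹‖D‖`. [formal bookkeeping] -/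
theorem norm_ramp_le (D : E3) (N : ℤ) (M : ℕ) (k : ℤ) : ‖ramp D N M k‖ ≤ (M : ℝ)⁻¹ * ‖D‖ := by
  unfold ramp
  split_ifs with h
  · rw [norm_smul, norm_inv, Real.norm_natCast]
  · rw [norm_zero]
    positivity

/-- the ramp climbs by exactly `D`: `Σ_{k ∈ [l, n)} ramp k = D` whenever `[l, n) ⊇ [N, N + M)` and `M ≥ 1`. [this file, g58] -/
theorem sum_ramp_eq (D : E3) {N : ℤ} {M : ℕ} (hM : 1 ≤ M) {l n : ℤ} (hl : l ≤ N) (hn : N + M ≤ n) :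
    ∑ k ∈ Ico l n, ramp D N M k = D := by
  unfold ramp
  rw [← sum_filter]
  have hf : ((Ico l n).filter fun k => N ≤ k ∧ k < N + M) = Ico N (N + M) := by
    ext k
    simp only [mem_filter, mem_Ico]
    omega
  have hM0 : (M : ℝ) ≠ 0 := Nat.cast_ne_zero.mpr (by omega)
  rw [hf, sum_const, Int.card_Ico, show (N + (M : ℤ) - N).toNat = M by omega, ← Nat.cast_smul_eq_nsmul ℝ, smul_smul,
    mul_inv_cancel₀ hM0, one_smul]

/-! ### VQ.2  ★★ The ramp estimate -/

/-- ★★ THE RAMP ESTIMATE: for an increment field `d` supported in a nonempty window `W` and every `M ≥ 1`,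
`(2κ₀ − ε)·Σ_{m ∈ W} ‖d m‖² ≤ 2·Σ_{m ∈ W} ⟪d m, blockApply (fluxBlock …) W d m⟫ + 2·(2r+1)·fluxConst·‖Σ_W d‖² / M`
(close `d` by the far slow ramp; apply VL (b1) + VO flux form to the profile of the closed field; split the pairing into the window share —
exactly the block pairing, VP `chainFlux_eq_sum_fluxBlock`, no cross blocks — and the ramp share, `≤ M` terms of size `O(M⁻²)`). [this file, g58] -/
theorem flux_coercive_step (hc : 0 < c) (hL : IsLayeredCrystal c a b w) {κ₀ ε ϱ : ℝ} (hϱ : 0 ≤ ϱ) (hε : ε ≤ 2 * κ₀)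
    (hK : CoerciveZ (layeredKernel a b w) κ₀)
    (hT : ∀ φ : Cell 2 → ℤ → E3, HasFiniteSupport φ → Summable (tailFam ϱ a b w φ) ∧ ∑' x, tailFam ϱ a b w φ x ≤ ε * nnFormZ φ)
    {W : Finset ℤ} (hne : W.Nonempty) {d : ℤ → E3} (hd : ∀ k, k ∉ W → d k = 0) {M : ℕ} (hM : 1 ≤ M) :
    (2 * κ₀ - ε) * ∑ m ∈ W, ‖d m‖ ^ 2 ≤ 2 * ∑ m ∈ W, ⟪d m, blockApply (fluxBlock hc hL ϱ) W d m⟫_ℝ +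
      2 * ((((2 * ⌊ϱ / c⌋₊ + 1 : ℕ)) : ℝ) * fluxConst c ϱ * ‖∑ k ∈ W, d k‖ ^ 2) / M := by
  -- the window's extreme layers and the foot of the ramp
  obtain ⟨lo, hlo_le, hlo_mem⟩ : ∃ lo : ℤ, (∀ k ∈ W, lo ≤ k) ∧ lo ∈ W := ⟨W.min' hne, fun k hk => W.min'_le k hk, W.min'_mem hne⟩
  obtain ⟨hi, hhi_le, hhi_mem⟩ : ∃ hi : ℤ, (∀ k ∈ W, k ≤ hi) ∧ hi ∈ W := ⟨W.max' hne, fun k hk => W.le_max' k hk, W.max'_mem hne⟩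
  have hlohi : lo ≤ hi := hlo_le hi hhi_mem
  obtain ⟨N, hN⟩ : ∃ N : ℤ, N = hi + ⌊ϱ / c⌋₊ + 2 := ⟨_, rfl⟩
  set D : E3 := ∑ k ∈ W, d k with hD
  have hM0 : (M : ℝ) ≠ 0 := Nat.cast_ne_zero.mpr (by omega)
  have hMpos : (0 : ℝ) < M := Nat.cast_pos.mpr (by omega)
  have hF := fluxConst_nonneg hc ϱ
  -- the closed increment field `k ↦ d k - ramp D N M k` and its profile `cf`
  have hdlo : ∀ n, n < lo → d n - ramp D N M n = 0 := by
    intro n hn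
    rw [hd n (fun h => by have := hlo_le n h; omega), ramp_eq_zero_of_lt D M (by omega : n < N), sub_zero]
  set cf : ℤ → E3 := primZ (fun k => d k - ramp D N M k) lo with hcf
  have hinc : ∀ n, cf (n + 1) - cf n = d n - ramp D N M n := fun n => primZ_succ_sub' _ hdlo n
  -- its support `S = [lo + 1, N + M - 1]`
  obtain ⟨S, hSdef⟩ : ∃ S : Finset ℤ, S = Icc (lo + 1) (N + M - 1) := ⟨_, rfl⟩
  have hWI : ∀ n : ℤ, N + M ≤ n → W ⊆ Ico lo n := fun n hn k hk => by
    have := hlo_le k hk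
    have := hhi_le k hk
    rw [mem_Ico]
    omega
  have hS : ∀ n, n ∉ S → cf n = 0 := by
    intro n hn
    rw [hSdef, mem_Icc, not_and_or, not_le, not_le] at hn
    rcases hn with hn | hn
    · exact primZ_of_le _ (by omega)
    · show ∑ k ∈ Ico lo n, (d k - ramp D N M k) = 0
      rw [sum_sub_distrib, sum_ramp_eq D hM (by omega : lo ≤ N) (by omega : N + M ≤ n),
        ← sum_subset (hWI n (by omega)) (fun k _ hk => hd k hk), ← hD, sub_self]
  -- the carrier: the band collar of the support
  obtain ⟨W', hSW', hW'band, hW'box⟩ : ∃ W' : Finset ℤ, S ⊆ W' ∧ (∀ α ∈ S, ∀ β : ℤ, c * |(((β - α : ℤ)) : ℝ)| ≤ ϱ → β ∈ W') ∧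
      ∀ m : ℤ, lo - 1 ≤ m → m ≤ N + M → Icc (m - ⌊ϱ / c⌋₊) (m + 1 + ⌊ϱ / c⌋₊) ⊆ W' := by
    refine ⟨Icc (lo - ⌊ϱ / c⌋₊ - 1) (N + M + ⌊ϱ / c⌋₊ + 1), fun α hα => ?_, fun α hα β hβ => ?_,
      fun m h1 h2 => Icc_subset_Icc (by omega) (by omega)⟩
    · rw [hSdef, mem_Icc] at hα
      rw [mem_Icc]
      omega
    · rw [hSdef, mem_Icc] at hα
      have := natAbs_le_floor_of_band hc hβ
      rw [mem_Icc]
      omega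
  -- VL (b1) for the profile, in VO's flux form, in terms of the closed field
  have hb1 := chainCoercive_of_coerciveZ_sum hc hL hϱ hε hK hT cf hS hSW' hW'band W
  rw [← chainForm_eq_sum hc hL hS hSW' hW'band, chainForm_eq_two_mul_sum_inner_chainFlux hc hL cf hS hSW' hW'band] at hb1
  simp only [hinc] at hb1
  have hlhs : ∑ m ∈ W, ‖d m - ramp D N M m‖ ^ 2 = ∑ m ∈ W, ‖d m‖ ^ 2 := sum_congr rfl fun m hm => by
    rw [ramp_eq_zero_of_lt D M (by have := hhi_le m hm; omega : m < N), sub_zero]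
  rw [hlhs] at hb1
  -- the flux in increment form along the support
  have hΦ : ∀ m : ℤ, lo - 1 ≤ m → m ≤ N + M →
      chainFlux ϱ a b w W' cf m = ∑ k ∈ Icc (m - ⌊ϱ / c⌋₊) (m + ⌊ϱ / c⌋₊), fluxBlock hc hL ϱ m k (d k - ramp D N M k) := by
    intro m h1 h2
    rw [chainFlux_eq_sum_fluxBlock hc hL cf (hW'box m h1 h2)]
    exact sum_congr rfl fun k _ => by rw [hinc k]
  -- (A) the window share: no cross blocks between `W` and the ramp
  have hA : ∀ m ∈ W, chainFlux ϱ a b w W' cf m = blockApply (fluxBlock hc hL ϱ) W d m := by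
    intro m hm
    have h1 := hlo_le m hm
    have h2 := hhi_le m hm
    rw [hΦ m (by omega) (by omega), blockApply]
    have hz : ∀ k ∈ Icc (m - (⌊ϱ / c⌋₊ : ℤ)) (m + ⌊ϱ / c⌋₊), fluxBlock hc hL ϱ m k (d k - ramp D N M k) = fluxBlock hc hL ϱ m k (d k) := by
      intro k hk
      rw [mem_Icc] at hk
      rw [ramp_eq_zero_of_lt D M (by omega : k < N), sub_zero]
    rw [sum_congr rfl hz]
    exact sum_eq_sum_of_vanish (fun k _ hkW => by rw [hd k hkW, map_zero])
      (fun k _ hk => by rw [fluxBlock_eq_zero_of_not_mem hc hL ϱ hk, zero_apply])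
  -- (B) the ramp share is `O(1/M)`
  have hUb : ∀ m ∈ S ∪ S.image (fun α => α - 1), lo - 1 ≤ m ∧ m ≤ N + M := by
    intro m hm
    rcases mem_union.mp hm with h | h
    · rw [hSdef, mem_Icc] at h
      omega
    · obtain ⟨α, hα, rfl⟩ := mem_image.mp h
      rw [hSdef, mem_Icc] at hα
      omega
  have hfar : ∀ k, hi < k → d k - ramp D N M k = -ramp D N M k := fun k hk => by
    rw [hd k (fun hkW => (not_le.mpr hk) (hhi_le k hkW)), zero_sub]
  have hΦn : ∀ m : ℤ, N ≤ m → m ≤ N + M →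
      ‖chainFlux ϱ a b w W' cf m‖ ≤ (((2 * ⌊ϱ / c⌋₊ + 1 : ℕ)) : ℝ) * fluxConst c ϱ * ((M : ℝ)⁻¹ * ‖D‖) := by
    intro m h1 h2
    rw [hΦ m (by omega) h2]
    calc ‖∑ k ∈ Icc (m - (⌊ϱ / c⌋₊ : ℤ)) (m + ⌊ϱ / c⌋₊), fluxBlock hc hL ϱ m k (d k - ramp D N M k)‖
        ≤ ∑ k ∈ Icc (m - (⌊ϱ / c⌋₊ : ℤ)) (m + ⌊ϱ / c⌋₊), ‖fluxBlock hc hL ϱ m k (d k - ramp D N M k)‖ := norm_sum_le _ _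
      _ ≤ ∑ k ∈ Icc (m - (⌊ϱ / c⌋₊ : ℤ)) (m + ⌊ϱ / c⌋₊), fluxConst c ϱ * ((M : ℝ)⁻¹ * ‖D‖) := sum_le_sum fun k hk => by
          rw [mem_Icc] at hk
          rw [hfar k (by omega), map_neg, norm_neg]
          exact (ContinuousLinearMap.le_opNorm _ _).trans
            (mul_le_mul (norm_fluxBlock_le hc hL hϱ m k) (norm_ramp_le D N M k) (norm_nonneg _) hF)
      _ = (((2 * ⌊ϱ / c⌋₊ + 1 : ℕ)) : ℝ) * fluxConst c ϱ * ((M : ℝ)⁻¹ * ‖D‖) := by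
          rw [sum_const, nsmul_eq_mul, Int.card_Icc, show (m + (⌊ϱ / c⌋₊ : ℤ) + 1 - (m - ⌊ϱ / c⌋₊)).toNat = 2 * ⌊ϱ / c⌋₊ + 1 by omega]
          ring
  have hterm : ∀ m ∈ S ∪ S.image (fun α => α - 1), |⟪ramp D N M m, chainFlux ϱ a b w W' cf m⟫_ℝ| ≤
      if N ≤ m ∧ m < N + M then (((2 * ⌊ϱ / c⌋₊ + 1 : ℕ)) : ℝ) * fluxConst c ϱ * ‖D‖ ^ 2 / (M : ℝ) ^ 2 else 0 := by
    intro m hm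
    obtain ⟨h1, h2⟩ := hUb m hm
    by_cases hP : N ≤ m ∧ m < N + M
    · rw [if_pos hP, ramp, if_pos hP]
      calc |⟪((M : ℝ)⁻¹) • D, chainFlux ϱ a b w W' cf m⟫_ℝ| ≤ ‖((M : ℝ)⁻¹) • D‖ * ‖chainFlux ϱ a b w W' cf m‖ := abs_real_inner_le_norm _ _
        _ ≤ ((M : ℝ)⁻¹ * ‖D‖) * ((((2 * ⌊ϱ / c⌋₊ + 1 : ℕ)) : ℝ) * fluxConst c ϱ * ((M : ℝ)⁻¹ * ‖D‖)) :=
            mul_le_mul (by rw [norm_smul, norm_inv, Real.norm_natCast]) (hΦn m hP.1 (by omega)) (norm_nonneg _) (by positivity)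
        _ = (((2 * ⌊ϱ / c⌋₊ + 1 : ℕ)) : ℝ) * fluxConst c ϱ * ‖D‖ ^ 2 / (M : ℝ) ^ 2 := by
            field_simp
    · rw [if_neg hP, ramp, if_neg hP, inner_zero_left, abs_zero]
  have hB : |∑ m ∈ S ∪ S.image (fun α => α - 1), ⟪ramp D N M m, chainFlux ϱ a b w W' cf m⟫_ℝ| ≤
      (((2 * ⌊ϱ / c⌋₊ + 1 : ℕ)) : ℝ) * fluxConst c ϱ * ‖D‖ ^ 2 / M := by
    refine (abs_sum_le_sum_abs _ _).trans ((sum_le_sum hterm).trans ?_)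
    rw [← sum_filter, sum_const, nsmul_eq_mul]
    have hcard : ((((S ∪ S.image (fun α => α - 1)).filter fun m => N ≤ m ∧ m < N + M).card : ℕ) : ℝ) ≤ M := by
      have hsub : ((S ∪ S.image (fun α => α - 1)).filter fun m => N ≤ m ∧ m < N + M) ⊆ Ico N (N + M) :=
        fun m hm => mem_Ico.mpr (mem_filter.mp hm).2
      have h := card_le_card hsub
      rw [Int.card_Ico, show (N + (M : ℤ) - N).toNat = M by omega] at h
      exact_mod_cast h
    calc ((((S ∪ S.image (fun α => α - 1)).filter fun m => N ≤ m ∧ m < N + M).card : ℕ) : ℝ) *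
          ((((2 * ⌊ϱ / c⌋₊ + 1 : ℕ)) : ℝ) * fluxConst c ϱ * ‖D‖ ^ 2 / (M : ℝ) ^ 2)
        ≤ (M : ℝ) * ((((2 * ⌊ϱ / c⌋₊ + 1 : ℕ)) : ℝ) * fluxConst c ϱ * ‖D‖ ^ 2 / (M : ℝ) ^ 2) :=
          mul_le_mul_of_nonneg_right hcard (by positivity)
      _ = (((2 * ⌊ϱ / c⌋₊ + 1 : ℕ)) : ℝ) * fluxConst c ϱ * ‖D‖ ^ 2 / M := by
          field_simp
  -- (C) assemble: the pairing splits into the window share and the ramp share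
  have hWU : W ⊆ S ∪ S.image (fun α => α - 1) := by
    intro m hm
    have h1 := hlo_le m hm
    have h2 := hhi_le m hm
    refine mem_union_right _ (mem_image.mpr ⟨m + 1, ?_, by ring⟩)
    rw [hSdef, mem_Icc]
    omega
  have hsubW : ∑ m ∈ W, ⟪d m, chainFlux ϱ a b w W' cf m⟫_ℝ = ∑ m ∈ S ∪ S.image (fun α => α - 1), ⟪d m, chainFlux ϱ a b w W' cf m⟫_ℝ :=
    sum_subset hWU fun m _ hm => by rw [hd m hm, inner_zero_left]
  have hAs : ∑ m ∈ W, ⟪d m, chainFlux ϱ a b w W' cf m⟫_ℝ = ∑ m ∈ W, ⟪d m, blockApply (fluxBlock hc hL ϱ) W d m⟫_ℝ :=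
    sum_congr rfl fun m hm => by rw [hA m hm]
  have hsplit : ∑ m ∈ S ∪ S.image (fun α => α - 1), ⟪d m - ramp D N M m, chainFlux ϱ a b w W' cf m⟫_ℝ =
      ∑ m ∈ W, ⟪d m, blockApply (fluxBlock hc hL ϱ) W d m⟫_ℝ -
        ∑ m ∈ S ∪ S.image (fun α => α - 1), ⟪ramp D N M m, chainFlux ϱ a b w W' cf m⟫_ℝ := by
    simp only [inner_sub_left, sum_sub_distrib]
    rw [← hsubW, hAs]
  rw [hsplit] at hb1
  have hnl := neg_le_abs (∑ m ∈ S ∪ S.image (fun α => α - 1), ⟪ramp D N M m, chainFlux ϱ a b w W' cf m⟫_ℝ)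
  have hgoal : 2 * ((((2 * ⌊ϱ / c⌋₊ + 1 : ℕ)) : ℝ) * fluxConst c ϱ * ‖D‖ ^ 2) / M =
      2 * ((((2 * ⌊ϱ / c⌋₊ + 1 : ℕ)) : ℝ) * fluxConst c ϱ * ‖D‖ ^ 2 / M) := by ring
  rw [hgoal]
  linarith [hb1, hB, hnl]

/-- ★★ coercivity of the flux blocks on increment fields SUPPORTED IN THE WINDOW (the ramp estimate as `M → ∞`). [this file, g58] -/
theorem flux_coercive_of_support (hc : 0 < c) (hL : IsLayeredCrystal c a b w) {κ₀ ε ϱ : ℝ} (hϱ : 0 ≤ ϱ) (hε : ε ≤ 2 * κ₀)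
    (hK : CoerciveZ (layeredKernel a b w) κ₀)
    (hT : ∀ φ : Cell 2 → ℤ → E3, HasFiniteSupport φ → Summable (tailFam ϱ a b w φ) ∧ ∑' x, tailFam ϱ a b w φ x ≤ ε * nnFormZ φ)
    {W : Finset ℤ} (hne : W.Nonempty) {d : ℤ → E3} (hd : ∀ k, k ∉ W → d k = 0) :
    (2 * κ₀ - ε) * ∑ m ∈ W, ‖d m‖ ^ 2 ≤ 2 * ∑ m ∈ W, ⟪d m, blockApply (fluxBlock hc hL ϱ) W d m⟫_ℝ := by
  have hF := fluxConst_nonneg hc ϱ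
  refine le_of_forall_pos_le_add fun η hη => ?_
  obtain ⟨n, hn⟩ := exists_nat_gt (2 * ((((2 * ⌊ϱ / c⌋₊ + 1 : ℕ)) : ℝ) * fluxConst c ϱ * ‖∑ k ∈ W, d k‖ ^ 2) / η)
  have hstep := flux_coercive_step hc hL hϱ hε hK hT hne hd (M := n + 1) (by omega)
  set C : ℝ := 2 * ((((2 * ⌊ϱ / c⌋₊ + 1 : ℕ)) : ℝ) * fluxConst c ϱ * ‖∑ k ∈ W, d k‖ ^ 2) with hC
  have hC0 : 0 ≤ C := by positivity
  have hM : (0 : ℝ) < ((n + 1 : ℕ) : ℝ) := by positivity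
  have hle : C / ((n + 1 : ℕ) : ℝ) ≤ η := by
    rw [div_le_iff₀ hM]
    rw [div_lt_iff₀ hη] at hn
    push_cast
    nlinarith
  linarith

/-- ★★ COERCIVITY OF THE FLUX BLOCKS ON EVERY WINDOW: under VL's hypotheses, for every finite window `W` of gaps and every increment field `d`,
`(κ₀ − ε/2)·Σ_{m ∈ W} ‖d m‖² ≤ Σ_{m ∈ W} ⟪d m, blockApply (fluxBlock …) W d m⟫` — hypothesis `hco` of VM `window_exists` / `window_unique` /
VN `window_solve` for the block family `fluxBlock hc hL ϱ`, with `δ = κ₀ − ε/2` INDEPENDENT of the window and of `ϱ`. [this file, g58] -/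
theorem flux_coercive (hc : 0 < c) (hL : IsLayeredCrystal c a b w) {κ₀ ε ϱ : ℝ} (hϱ : 0 ≤ ϱ) (hε : ε ≤ 2 * κ₀)
    (hK : CoerciveZ (layeredKernel a b w) κ₀)
    (hT : ∀ φ : Cell 2 → ℤ → E3, HasFiniteSupport φ → Summable (tailFam ϱ a b w φ) ∧ ∑' x, tailFam ϱ a b w φ x ≤ ε * nnFormZ φ)
    (W : Finset ℤ) (d : ℤ → E3) :
    (κ₀ - ε / 2) * ∑ m ∈ W, ‖d m‖ ^ 2 ≤ ∑ m ∈ W, ⟪d m, blockApply (fluxBlock hc hL ϱ) W d m⟫_ℝ := by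
  rcases W.eq_empty_or_nonempty with hW | hne
  · simp [hW]
  -- truncate `d` to the window: both sides only see `d` on `W`
  obtain ⟨d₀, hd₀W, hd₀0⟩ : ∃ d₀ : ℤ → E3, (∀ k ∈ W, d₀ k = d k) ∧ ∀ k, k ∉ W → d₀ k = 0 :=
    ⟨fun k => if k ∈ W then d k else 0, fun k hk => if_pos hk, fun k hk => if_neg hk⟩
  have h := flux_coercive_of_support hc hL hϱ hε hK hT hne hd₀0
  have h1 : ∑ m ∈ W, ‖d₀ m‖ ^ 2 = ∑ m ∈ W, ‖d m‖ ^ 2 := sum_congr rfl fun m hm => by rw [hd₀W m hm]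
  have h2 : ∀ m ∈ W, blockApply (fluxBlock hc hL ϱ) W d₀ m = blockApply (fluxBlock hc hL ϱ) W d m := fun m _ => by
    unfold blockApply
    exact sum_congr rfl fun k hk => by rw [hd₀W k hk]
  have h3 : ∑ m ∈ W, ⟪d₀ m, blockApply (fluxBlock hc hL ϱ) W d₀ m⟫_ℝ = ∑ m ∈ W, ⟪d m, blockApply (fluxBlock hc hL ϱ) W d m⟫_ℝ :=
    sum_congr rfl fun m hm => by rw [hd₀W m hm, h2 m hm]
  rw [h1, h3] at h
  linarith

end IncrementCoercive

end Summit.AtomisticToContinuum.Crystallization.Theorems.ChartedZeroExcessLayeredLatticeLiouville
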